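import Literature.Topology.FourManifolds.TrisectionsImplantPrelim
import Literature.Topology.FourManifolds.TrisectionsImplantGlue
import HarnessLib

/-!
# One sector through the implant: the raw ambient presentation of a modified sector

Topic `Literature/Topology/FourManifolds`; infrastructure for the fact seat
`provefact-Literature.Topology.FourManifolds.exists-14560f9fc8` (named fact (c′)
`Literature.Topology.FourManifolds.exists_stabilized_gkTrisection`, Gay–Kirby 2016, Def. 8 and
Lemma 10).  Everything in this file is **proved**; no definitions, no named facts.

The stabilisation implant (`TrisectionsImplantModel.lean`) is glued into the closed
`4`-manifold `X` through a chart `Θ` of the maximal atlas (`TrisectionsImplantGlue.lean`).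
This file treats **one sector** abstractly: an old sector `S` presented by ambient data
(`G = 1 - 2 u_m v_m κ₀` with *constant* `κ₀` on an open `Bx ⊇ KX`, `KX` the compact carrier of
the modification), old and new normal coordinates `(u_m, v_m)`, `(u'_m, v'_m)` which through
`Θ` are model functions `a, b` and `aN, bN` on `ℝ⁴` and agree off `KX`, and the modified set
`S'` (`= {u'_m, v'_m ≥ 0}` in `U`, `= S` off `KX`).  From the model facts — `aN, bN` regular
everywhere, `-aN bN` regular at the face points and with its critical points in the open
quadrant forming a finite set `Xs` of nondegenerate points of index `1` — it derives the
clauses of a raw ambient presentation of `S'` by `G' = G + 2κ₀(u_m v_m - u'_m v'_m)`: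
interior points, `G' = 1` / `< 1`, regularity at the faces, nondegeneracy, and the counts
`c n + [n = 1] · #Xs` (`sector_rawPresentation_of_implant`).

## References

* D. Gay, R. Kirby, *Trisecting 4-manifolds*, Geom. Topol. 20 (2016) 3097–3132, Def. 8 and
  proof of Lemma 10. [GayKirby2016]
* J. Milnor, *Morse theory* (1963), §§2–3. [Milnor1963]
-/

open scoped Manifold ContDiff Topology Classical
open Set Function Filter

noncomputable section

namespace Literature.Topology.FourManifolds

universe u

section Sector

variable {X : Type u} [TopologicalSpace X] [T2Space X] [CompactSpace X]
  [ChartedSpace (EuclideanSpace ℝ (Fin 4)) X] [IsManifold (𝓡 4) ∞ X]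

/-- **One sector through the implant** (see the module docstring for the setting and the
conclusion). [cite: GayKirby2016, Def. 8 and proof of Lemma 10; Milnor1963, §§2–3] -/
theorem sector_rawPresentation_of_implant
    -- the chart and the carrier
    {Θ : OpenPartialHomeomorph X (EuclideanSpace ℝ (Fin 4))}
    (hΘ : Θ ∈ IsManifold.maximalAtlas (𝓡 4) ∞ X)
    {U KX : Set X} (hUo : IsOpen U) (hsrcU : Θ.source ⊆ U) (hKXc : IsCompact KX)
    (hKXsrc : KX ⊆ Θ.source)
    -- the old sector and its presentation
    {S F : Set X} (hSc : IsCompact S) {um vm : X → ℝ}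
    (hums : ContMDiff (𝓡 4) 𝓘(ℝ, ℝ) ∞ um) (hvms : ContMDiff (𝓡 4) 𝓘(ℝ, ℝ) ∞ vm)
    (hint : ∀ y ∈ U, y ∈ S → (y ∈ interior S ↔ 0 < um y ∧ 0 < vm y))
    (hFnotint : ∀ x ∈ F, x ∉ interior S)
    {G κ : X → ℝ} {Oκ Bx : Set X} {κ₀ : ℝ} (hGs : ContMDiff (𝓡 4) 𝓘(ℝ, ℝ) ∞ G)
    (hOκo : IsOpen Oκ) (hFOκ : F ⊆ Oκ)
    (hGform : ∀ y ∈ Oκ, G y = 1 - 2 * um y * vm y * κ y)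
    (hb1 : ∀ p ∈ S, p ∉ interior S → G p = 1) (hi1 : ∀ p ∈ interior S, G p < 1)
    (hb2 : ∀ p ∈ S, p ∉ interior S → p ∉ F → ¬ IsMCriticalPt (𝓡 4) G p)
    (hi2 : ∀ p ∈ interior S, IsMCriticalPt (𝓡 4) G p → (mhessian (𝓡 4) G p).Nondegenerate)
    (hnocrit : ∀ p ∈ S, p ∈ Oκ → p ∉ F → ¬ IsMCriticalPt (𝓡 4) G p)
    {c : ℕ → ℕ} (hc : ∀ n, (interior S ∩ criticalSetOfIndex (𝓡 4) G n).ncard = c n)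
    (hBxo : IsOpen Bx) (hKXBx : KX ⊆ Bx) (hBxOκ : Bx ⊆ Oκ) (hκconst : ∀ y ∈ Bx, κ y = κ₀)
    (hκ₀ : 0 < κ₀)
    -- the new sector and the new corner locus
    {Sn Fn : Set X} {un vn : X → ℝ}
    (huns : ContMDiff (𝓡 4) 𝓘(ℝ, ℝ) ∞ un) (hvns : ContMDiff (𝓡 4) 𝓘(ℝ, ℝ) ∞ vn)
    (hmemn : ∀ y ∈ U, y ∈ Sn ↔ 0 ≤ un y ∧ 0 ≤ vn y)
    (hSnS : ∀ y ∉ KX, y ∈ Sn ↔ y ∈ S)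
    (hFnmem : ∀ y ∈ U, y ∈ Fn ↔ un y = 0 ∧ vn y = 0) (hFnF : ∀ y ∉ KX, y ∈ Fn ↔ y ∈ F)
    (hun : ∀ y ∉ KX, un y = um y) (hvn : ∀ y ∉ KX, vn y = vm y)
    -- the model
    {am bm aN bN : EuclideanSpace ℝ (Fin 4) → ℝ}
    (haNs : ContDiff ℝ ∞ aN) (hbNs : ContDiff ℝ ∞ bN)
    (hum_src : ∀ y ∈ Θ.source, um y = am (Θ y)) (hvm_src : ∀ y ∈ Θ.source, vm y = bm (Θ y))
    (hun_src : ∀ y ∈ Θ.source, un y = aN (Θ y)) (hvn_src : ∀ y ∈ Θ.source, vn y = bN (Θ y))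
    (haNreg : ∀ z, fderiv ℝ aN z ≠ 0) (hbNreg : ∀ z, fderiv ℝ bN z ≠ 0)
    (hface1 : ∀ z, aN z = 0 → 0 < bN z → ¬ IsMCriticalPt (𝓡 4) (fun z => -(aN z * bN z)) z)
    (hface2 : ∀ z, bN z = 0 → 0 < aN z → ¬ IsMCriticalPt (𝓡 4) (fun z => -(aN z * bN z)) z)
    {Xs : Set (EuclideanSpace ℝ (Fin 4))} (hXsfin : Xs.Finite) (hXsT : Xs ⊆ Θ.target)
    (hXsKX : ∀ z ∈ Xs, Θ.symm z ∈ KX)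
    (hXs : ∀ z ∈ Xs, 0 < aN z ∧ 0 < bN z ∧ IsMCriticalPt (𝓡 4) (fun z => -(aN z * bN z)) z ∧
      (mhessian (𝓡 4) (fun z => -(aN z * bN z)) z).Nondegenerate ∧
      morseIndex (𝓡 4) (fun z => -(aN z * bN z)) z = 1)
    (hcrit : ∀ z ∈ Θ.target, Θ.symm z ∈ KX → 0 < aN z → 0 < bN z →
      IsMCriticalPt (𝓡 4) (fun z => -(aN z * bN z)) z → z ∈ Xs) :
    (∀ y ∈ U, y ∈ Sn → (y ∈ interior Sn ↔ 0 < un y ∧ 0 < vn y)) ∧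
    ContMDiff (𝓡 4) 𝓘(ℝ, ℝ) ∞ (fun y => G y + 2 * κ₀ * (um y * vm y - un y * vn y)) ∧
    (∀ y ∈ Oκ ∩ (KXᶜ ∪ Bx), G y + 2 * κ₀ * (um y * vm y - un y * vn y) = 1 - 2 * un y * vn y * κ y) ∧
    (∀ p ∈ Sn, p ∉ interior Sn → G p + 2 * κ₀ * (um p * vm p - un p * vn p) = 1) ∧
    (∀ p ∈ interior Sn, G p + 2 * κ₀ * (um p * vm p - un p * vn p) < 1) ∧
    (∀ p ∈ Sn, p ∉ interior Sn → p ∉ Fn →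
      ¬ IsMCriticalPt (𝓡 4) (fun y => G y + 2 * κ₀ * (um y * vm y - un y * vn y)) p) ∧
    (∀ p ∈ interior Sn, IsMCriticalPt (𝓡 4) (fun y => G y + 2 * κ₀ * (um y * vm y - un y * vn y)) p →
      (mhessian (𝓡 4) (fun y => G y + 2 * κ₀ * (um y * vm y - un y * vn y)) p).Nondegenerate) ∧
    (∀ n, (interior Sn ∩ criticalSetOfIndex (𝓡 4)
        (fun y => G y + 2 * κ₀ * (um y * vm y - un y * vn y)) n).ncard =
      c n + if n = 1 then Xs.ncard else 0) := by
  set Gn : X → ℝ := fun y => G y + 2 * κ₀ * (um y * vm y - un y * vn y) with hGn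
  set q : EuclideanSpace ℝ (Fin 4) → ℝ := fun z => -(aN z * bN z) with hq
  have hqs : ContDiff ℝ ∞ q := (haNs.mul hbNs).neg
  have hKXcl : IsClosed KX := hKXc.isClosed
  have hKXU : KX ⊆ U := hKXsrc.trans hsrcU
  have hKXOκ : KX ⊆ Oκ := hKXBx.trans hBxOκ
  have hGns : ContMDiff (𝓡 4) 𝓘(ℝ, ℝ) ∞ Gn :=
    hGs.add (contMDiff_const.mul ((hums.mul hvms).sub (huns.mul hvns)))
  -- ### off `KX`: `Gn = G`, `Sn = S`, `Fn = F`, locally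
  have hGn_off : ∀ y ∉ KX, Gn y = G y := by
    intro y hy
    simp only [hGn, hun y hy, hvn y hy, sub_self, mul_zero, add_zero]
  have hGn_far : ∀ y ∉ KX, Gn =ᶠ[𝓝 y] fun w => G w + 0 := by
    intro y hy
    filter_upwards [hKXcl.isOpen_compl.mem_nhds hy] with w hw
    rw [hGn_off w hw, add_zero]
  have hSnS_eq : Sn ∩ KXᶜ = S ∩ KXᶜ := by
    ext y; constructor
    · rintro ⟨h1, h2⟩; exact ⟨(hSnS y h2).1 h1, h2⟩
    · rintro ⟨h1, h2⟩; exact ⟨(hSnS y h2).2 h1, h2⟩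
  have hint_off : ∀ y ∉ KX, (y ∈ interior Sn ↔ y ∈ interior S) := fun y hy =>
    mem_interior_iff_of_inter_eq hKXcl.isOpen_compl hSnS_eq hy
  -- ### on the chart over `Bx`: `Gn = 1 + 2κ₀ q ∘ Θ`
  have hGn_src : ∀ y ∈ Θ.source, y ∈ Bx → Gn y = 1 + 2 * κ₀ * q (Θ y) := by
    intro y hy hyB
    have hyO : y ∈ Oκ := hBxOκ hyB
    simp only [hGn, hq]
    rw [hGform y hyO, hκconst y hyB, hum_src y hy, hvm_src y hy, hun_src y hy, hvn_src y hy]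
    ring
  have hGn_model : ∀ y ∈ Θ.source, y ∈ Bx →
      (Gn ∘ Θ.symm) =ᶠ[𝓝 (Θ y)] fun z => 1 + 2 * κ₀ * q z := by
    intro y hy hyB
    have h1 : ∀ᶠ z in 𝓝 (Θ y), z ∈ Θ.target ∧ Θ.symm z ∈ Bx := by
      have ha : ∀ᶠ z in 𝓝 (Θ y), z ∈ Θ.target := Θ.open_target.mem_nhds (Θ.map_source hy)
      have hb : ∀ᶠ z in 𝓝 (Θ y), Θ.symm z ∈ Bx := by
        have hc : ContinuousAt Θ.symm (Θ y) := Θ.continuousAt_symm (Θ.map_source hy)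
        apply hc.preimage_mem_nhds
        rw [Θ.left_inv hy]; exact hBxo.mem_nhds hyB
      exact ha.and hb
    filter_upwards [h1] with z hz
    simp only [comp_apply]
    rw [hGn_src _ (Θ.map_target hz.1) hz.2, Θ.right_inv hz.1]
  -- Morse data of `Gn` at points of the source over `Bx`, read through `q`
  have hmorse : ∀ y ∈ Θ.source, y ∈ Bx →
      (IsMCriticalPt (𝓡 4) Gn y ↔ IsMCriticalPt (𝓡 4) q (Θ y)) ∧
      (IsMCriticalPt (𝓡 4) Gn y →
        ((mhessian (𝓡 4) Gn y).Nondegenerate ↔ (mhessian (𝓡 4) q (Θ y)).Nondegenerate) ∧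
        morseIndex (𝓡 4) Gn y = morseIndex (𝓡 4) q (Θ y)) := by
    intro y hy hyB
    obtain ⟨h1, h2⟩ := morseData_of_comp_symm_eventuallyEq hΘ hGns hy (hGn_model y hy hyB)
    obtain ⟨h3, h4, h5⟩ := morseData_const_add_smul (hqs.of_le (by norm_cast)) (a := (1:ℝ))
      (mul_pos two_pos hκ₀) (Θ y)
    refine ⟨h1.trans h3, fun hcr => ?_⟩
    obtain ⟨h2a, h2b⟩ := h2 hcr
    exact ⟨h2a.trans h4, h2b.trans h5⟩
  -- ### regularity of the new coordinates on the source
  have hunreg : ∀ y ∈ Θ.source, ¬ IsMCriticalPt (𝓡 4) un y := by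
    intro y hy hcr
    have heq : (un ∘ Θ.symm) =ᶠ[𝓝 (Θ y)] aN := by
      filter_upwards [Θ.open_target.mem_nhds (Θ.map_source hy)] with z hz
      simp only [comp_apply, hun_src _ (Θ.map_target hz), Θ.right_inv hz]
    have h1 := (morseData_of_comp_symm_eventuallyEq hΘ huns hy heq).1
    rw [h1, MorseBirth.isMCriticalPt_iff_fderiv] at hcr
    exact haNreg _ hcr
  have hvnreg : ∀ y ∈ Θ.source, ¬ IsMCriticalPt (𝓡 4) vn y := by
    intro y hy hcr
    have heq : (vn ∘ Θ.symm) =ᶠ[𝓝 (Θ y)] bN := by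
      filter_upwards [Θ.open_target.mem_nhds (Θ.map_source hy)] with z hz
      simp only [comp_apply, hvn_src _ (Θ.map_target hz), Θ.right_inv hz]
    have h1 := (morseData_of_comp_symm_eventuallyEq hΘ hvns hy heq).1
    rw [h1, MorseBirth.isMCriticalPt_iff_fderiv] at hcr
    exact hbNreg _ hcr
  -- ### interior points of `Sn` inside `U`
  have hintn : ∀ y ∈ U, y ∈ Sn → (y ∈ interior Sn ↔ 0 < un y ∧ 0 < vn y) := by
    intro y hyU hySn
    constructor
    · intro hyint
      obtain ⟨hu0, hv0⟩ := (hmemn y hyU).1 hySn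
      by_cases hysrc : y ∈ Θ.source
      · -- via the regularity of `un`, `vn`
        have key : ∀ {w : X → ℝ}, ContMDiff (𝓡 4) 𝓘(ℝ, ℝ) ∞ w → ¬ IsMCriticalPt (𝓡 4) w y →
            (∀ z ∈ U, z ∈ Sn → 0 ≤ w z) → 0 ≤ w y → 0 < w y := by
          intro w hws hreg hpos hw0
          rcases hw0.lt_or_eq with hlt | heq0
          · exact hlt
          · exfalso
            have hcl := mem_closure_setOf_lt_zero_of_not_isMCriticalPt hws heq0.symm hreg
            rw [mem_closure_iff_nhds] at hcl
            obtain ⟨z, hzN, hzneg⟩ := hcl (interior Sn ∩ U)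
              (Filter.inter_mem (isOpen_interior.mem_nhds hyint) (hUo.mem_nhds hyU))
            have := hpos z hzN.2 (interior_subset hzN.1)
            exact absurd hzneg (not_lt.2 this)
        exact ⟨key huns (hunreg y hysrc) (fun z hz hzS => ((hmemn z hz).1 hzS).1) hu0,
          key hvns (hvnreg y hysrc) (fun z hz hzS => ((hmemn z hz).1 hzS).2) hv0⟩
      · have hyK : y ∉ KX := fun h => hysrc (hKXsrc h)
        have hyintS : y ∈ interior S := (hint_off y hyK).1 hyint
        have hyS : y ∈ S := (hSnS y hyK).1 hySn
        have := (hint y hyU hyS).1 hyintS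
        rwa [← hun y hyK, ← hvn y hyK] at this
    · rintro ⟨hu', hv'⟩
      have hopen : IsOpen (U ∩ (un ⁻¹' Ioi 0 ∩ vn ⁻¹' Ioi 0)) :=
        hUo.inter ((isOpen_Ioi.preimage huns.continuous).inter (isOpen_Ioi.preimage hvns.continuous))
      exact mem_interior.2 ⟨_, fun z hz => (hmemn z hz.1).2 ⟨le_of_lt hz.2.1, le_of_lt hz.2.2⟩, hopen,
        ⟨hyU, hu', hv'⟩⟩
  have hFnnotint : ∀ y ∈ Fn, y ∉ interior Sn := by
    intro y hyFn hyint
    by_cases hyK : y ∈ KX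
    · have hyU := hKXU hyK
      obtain ⟨hu0, hv0⟩ := (hFnmem y hyU).1 hyFn
      have := ((hintn y hyU (interior_subset hyint)).1 hyint).1
      rw [hu0] at this; exact lt_irrefl _ this
    · exact hFnotint y ((hFnF y hyK).1 hyFn) ((hint_off y hyK).1 hyint)
  -- ### the corner-form identity
  have hGformn : ∀ y ∈ Oκ ∩ (KXᶜ ∪ Bx), Gn y = 1 - 2 * un y * vn y * κ y := by
    rintro y ⟨hyO, hyK | hyB⟩
    · have hyK' : y ∉ KX := hyK
      rw [hGn_off y hyK', hGform y hyO, hun y hyK', hvn y hyK']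
    · by_cases hyK' : y ∈ KX
      · rw [hGn_src y (hKXsrc hyK') hyB, hκconst y hyB]
        simp only [hq, hun_src y (hKXsrc hyK'), hvn_src y (hKXsrc hyK')]
        ring
      · rw [hGn_off y hyK', hGform y hyO, hun y hyK', hvn y hyK']
  -- points of `KX`: in the source, in `Bx`, in `U`
  have hKXfacts : ∀ p ∈ KX, p ∈ Θ.source ∧ p ∈ Bx ∧ p ∈ U := fun p hp =>
    ⟨hKXsrc hp, hKXBx hp, hKXU hp⟩
  -- ### `Gn = 1` at the non-interior points
  have hb1n : ∀ p ∈ Sn, p ∉ interior Sn → Gn p = 1 := by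
    intro p hpSn hnot
    by_cases hpK : p ∈ KX
    · obtain ⟨hpsrc, hpB, hpU⟩ := hKXfacts p hpK
      rw [hGn_src p hpsrc hpB]
      obtain ⟨hu0, hv0⟩ := (hmemn p hpU).1 hpSn
      have hzero : un p = 0 ∨ vn p = 0 := by
        by_contra hne
        rw [not_or] at hne
        exact hnot ((hintn p hpU hpSn).2 ⟨lt_of_le_of_ne hu0 (Ne.symm hne.1), lt_of_le_of_ne hv0 (Ne.symm hne.2)⟩)
      simp only [hq, ← hun_src p hpsrc, ← hvn_src p hpsrc]
      rcases hzero with h0 | h0 <;> simp [h0]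
    · rw [hGn_off p hpK]
      exact hb1 p ((hSnS p hpK).1 hpSn) (fun h => hnot ((hint_off p hpK).2 h))
  -- ### `Gn < 1` at the interior points
  have hi1n : ∀ p ∈ interior Sn, Gn p < 1 := by
    intro p hpint
    have hpSn : p ∈ Sn := interior_subset hpint
    by_cases hpK : p ∈ KX
    · obtain ⟨hpsrc, hpB, hpU⟩ := hKXfacts p hpK
      rw [hGn_src p hpsrc hpB]
      obtain ⟨hu', hv'⟩ := (hintn p hpU hpSn).1 hpint
      simp only [hq, ← hun_src p hpsrc, ← hvn_src p hpsrc]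
      nlinarith [mul_pos (mul_pos hu' hv') hκ₀]
    · rw [hGn_off p hpK]
      exact hi1 p ((hint_off p hpK).1 hpint)
  -- ### regularity at the non-interior points off `Fn`
  have hb2n : ∀ p ∈ Sn, p ∉ interior Sn → p ∉ Fn → ¬ IsMCriticalPt (𝓡 4) Gn p := by
    intro p hpSn hnot hpFn
    by_cases hpK : p ∈ KX
    · obtain ⟨hpsrc, hpB, hpU⟩ := hKXfacts p hpK
      obtain ⟨hu0, hv0⟩ := (hmemn p hpU).1 hpSn
      rw [(hmorse p hpsrc hpB).1]
      have hnotboth : ¬ (un p = 0 ∧ vn p = 0) := fun h => hpFn ((hFnmem p hpU).2 h)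
      have hzero : un p = 0 ∨ vn p = 0 := by
        by_contra hne
        rw [not_or] at hne
        exact hnot ((hintn p hpU hpSn).2 ⟨lt_of_le_of_ne hu0 (Ne.symm hne.1), lt_of_le_of_ne hv0 (Ne.symm hne.2)⟩)
      rcases hzero with h0 | h0
      · have hv' : 0 < vn p := lt_of_le_of_ne hv0 fun h => hnotboth ⟨h0, h.symm⟩
        rw [hun_src p hpsrc] at h0
        rw [hvn_src p hpsrc] at hv'
        exact hface1 _ h0 hv'
      · have hu' : 0 < un p := lt_of_le_of_ne hu0 fun h => hnotboth ⟨h.symm, h0⟩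
        rw [hvn_src p hpsrc] at h0
        rw [hun_src p hpsrc] at hu'
        exact hface2 _ h0 hu'
    · rw [isMCriticalPt_congr_of_eventuallyEq_add_const (hGn_far p hpK)]
      exact hb2 p ((hSnS p hpK).1 hpSn) (fun h => hnot ((hint_off p hpK).2 h))
        (fun hpF => hpFn ((hFnF p hpK).2 hpF))
  -- ### the new critical points over `KX` are the points of `Xs`
  have hnewcrit : ∀ p ∈ interior Sn, p ∈ KX → IsMCriticalPt (𝓡 4) Gn p → Θ p ∈ Xs := by
    intro p hpint hpK hcr
    obtain ⟨hpsrc, hpB, hpU⟩ := hKXfacts p hpK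
    obtain ⟨hu', hv'⟩ := (hintn p hpU (interior_subset hpint)).1 hpint
    rw [(hmorse p hpsrc hpB).1] at hcr
    refine hcrit _ (Θ.map_source hpsrc) (by rw [Θ.left_inv hpsrc]; exact hpK) ?_ ?_ hcr
    · rwa [← hun_src p hpsrc]
    · rwa [← hvn_src p hpsrc]
  -- ### nondegeneracy at the interior critical points
  have hi2n : ∀ p ∈ interior Sn, IsMCriticalPt (𝓡 4) Gn p → (mhessian (𝓡 4) Gn p).Nondegenerate := by
    intro p hpint hcr
    by_cases hpK : p ∈ KX
    · obtain ⟨hpsrc, hpB, hpU⟩ := hKXfacts p hpK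
      have hXmem := hnewcrit p hpint hpK hcr
      obtain ⟨-, -, -, hnd, -⟩ := hXs _ hXmem
      rw [((hmorse p hpsrc hpB).2 hcr).1]
      exact hnd
    · rw [mhessian_congr_of_eventuallyEq_add_const (hGn_far p hpK)]
      rw [isMCriticalPt_congr_of_eventuallyEq_add_const (hGn_far p hpK)] at hcr
      exact hi2 p ((hint_off p hpK).1 hpint) hcr
  -- ### the counts
  have hold_fin : (interior S ∩ criticalSet (𝓡 4) G).Finite :=
    finite_interior_inter_criticalSet hSc hGs hOκo hFOκ hFnotint hb2 hnocrit hi2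
  have hold_notK : ∀ p ∈ interior S, IsMCriticalPt (𝓡 4) G p → p ∉ KX := by
    intro p hpint hcr hpK
    exact hnocrit p (interior_subset hpint) (hKXOκ hpK) (fun hpF => hFnotint p hpF hpint) hcr
  have himage_int : ∀ z ∈ Xs, Θ.symm z ∈ interior Sn ∧ IsMCriticalPt (𝓡 4) Gn (Θ.symm z) ∧
      morseIndex (𝓡 4) Gn (Θ.symm z) = 1 := by
    intro z hz
    obtain ⟨ha, hb, hcrz, -, hidx⟩ := hXs z hz
    have hyK : Θ.symm z ∈ KX := hXsKX z hz
    obtain ⟨hysrc, hyB, hyU⟩ := hKXfacts _ hyK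
    have hΘy : Θ (Θ.symm z) = z := Θ.right_inv (hXsT hz)
    have hun' : un (Θ.symm z) = aN z := by rw [hun_src _ hysrc, hΘy]
    have hvn' : vn (Θ.symm z) = bN z := by rw [hvn_src _ hysrc, hΘy]
    have hySn : Θ.symm z ∈ Sn := (hmemn _ hyU).2 ⟨by rw [hun']; exact ha.le, by rw [hvn']; exact hb.le⟩
    have hyint : Θ.symm z ∈ interior Sn :=
      (hintn _ hyU hySn).2 ⟨by rw [hun']; exact ha, by rw [hvn']; exact hb⟩
    have hcr : IsMCriticalPt (𝓡 4) Gn (Θ.symm z) := by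
      rw [(hmorse _ hysrc hyB).1, hΘy]; exact hcrz
    refine ⟨hyint, hcr, ?_⟩
    rw [((hmorse _ hysrc hyB).2 hcr).2, hΘy]; exact hidx
  have hcn : ∀ n, (interior Sn ∩ criticalSetOfIndex (𝓡 4) Gn n).ncard =
      c n + if n = 1 then Xs.ncard else 0 := by
    intro n
    -- the old part
    have hold_eq : interior Sn ∩ criticalSetOfIndex (𝓡 4) Gn n ∩ KXᶜ =
        interior S ∩ criticalSetOfIndex (𝓡 4) G n := by
      ext p
      simp only [mem_inter_iff, mem_criticalSetOfIndex, mem_compl_iff]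
      constructor
      · rintro ⟨⟨hpint, hcr, hidx⟩, hpK⟩
        refine ⟨(hint_off p hpK).1 hpint, ?_, ?_⟩
        · rwa [isMCriticalPt_congr_of_eventuallyEq_add_const (hGn_far p hpK)] at hcr
        · unfold morseIndex at hidx ⊢
          rwa [mhessian_congr_of_eventuallyEq_add_const (hGn_far p hpK)] at hidx
      · rintro ⟨hpint, hcr, hidx⟩
        have hpK : p ∉ KX := hold_notK p hpint hcr
        refine ⟨⟨(hint_off p hpK).2 hpint, ?_, ?_⟩, hpK⟩
        · rwa [isMCriticalPt_congr_of_eventuallyEq_add_const (hGn_far p hpK)]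
        · unfold morseIndex at hidx ⊢
          rwa [mhessian_congr_of_eventuallyEq_add_const (hGn_far p hpK)]
    -- the new part
    have hnew_eq : interior Sn ∩ criticalSetOfIndex (𝓡 4) Gn n ∩ KX =
        if n = 1 then Θ.symm '' Xs else ∅ := by
      ext p
      simp only [mem_inter_iff, mem_criticalSetOfIndex]
      constructor
      · rintro ⟨⟨hpint, hcr, hidx⟩, hpK⟩
        obtain ⟨hpsrc, hpB, hpU⟩ := hKXfacts p hpK
        have hXmem := hnewcrit p hpint hpK hcr
        obtain ⟨-, -, -, -, hidx1⟩ := hXs _ hXmem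
        have hn : n = 1 := by
          rw [← hidx, ((hmorse p hpsrc hpB).2 hcr).2, hidx1]
        subst hn
        simp only [if_true]
        exact ⟨Θ p, hXmem, Θ.left_inv hpsrc⟩
      · intro hp
        by_cases hn : n = 1
        · subst hn
          simp only [if_true] at hp
          obtain ⟨z, hz, rfl⟩ := hp
          obtain ⟨hyint, hcr, hidx⟩ := himage_int z hz
          exact ⟨⟨hyint, hcr, hidx⟩, hXsKX z hz⟩
        · simp only [hn, if_false, mem_empty_iff_false] at hp
    -- assemble
    have hsplit : interior Sn ∩ criticalSetOfIndex (𝓡 4) Gn n =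
        (interior Sn ∩ criticalSetOfIndex (𝓡 4) Gn n ∩ KXᶜ) ∪
          (interior Sn ∩ criticalSetOfIndex (𝓡 4) Gn n ∩ KX) := by
      rw [← inter_union_distrib_left, compl_union_self, inter_univ]
    have hdisj : Disjoint (interior Sn ∩ criticalSetOfIndex (𝓡 4) Gn n ∩ KXᶜ)
        (interior Sn ∩ criticalSetOfIndex (𝓡 4) Gn n ∩ KX) :=
      Set.disjoint_left.2 fun p hp hp' => hp.2 hp'.2
    have hfin1 : (interior Sn ∩ criticalSetOfIndex (𝓡 4) Gn n ∩ KXᶜ).Finite := by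
      rw [hold_eq]
      exact hold_fin.subset (inter_subset_inter_right _ (criticalSetOfIndex_subset _ _ _))
    have hfin2 : (interior Sn ∩ criticalSetOfIndex (𝓡 4) Gn n ∩ KX).Finite := by
      rw [hnew_eq]
      split_ifs
      · exact hXsfin.image _
      · exact finite_empty
    rw [hsplit, Set.ncard_union_eq hdisj hfin1 hfin2, hold_eq, hc n, hnew_eq]
    split_ifs with hn
    · rw [(Θ.symm.injOn.mono hXsT).ncard_image]
    · rw [ncard_empty]
  exact ⟨hintn, hGns, hGformn, hb1n, hi1n, hb2n, hi2n, hcn⟩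

end Sector

end Literature.Topology.FourManifolds
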